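import Literature.NumberTheory.EllipticCurves.Gamma0RankinSelbergScaledUnfolding
import Literature.NumberTheory.EllipticCurves.Gamma0RankinSelbergResidue
import Literature.NumberTheory.Automorphic.RankinSelbergContinuationSL2
import HarnessLib

/-!
# Rankin's Dirichlet series `Σ |aₙ|² n^{-w}` of `f ∈ S₂(Γ₀(N))` through horocycle data on the modular
# surface: `Σₙ |aₙ|² n^{-(σ+1)} = J_σ(N)⁻¹ Σ_{t∣N} μ(N/t) t^σ (Nt)^{σ+1} Σₙ conjCoeff_t(n) n^{-(σ+1)}`

Topic `Literature/NumberTheory/EllipticCurves`; theorems only. The assembly, at real `σ > 1`, of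
* Step A of the tree's Rankin–Selberg unfolding on `Γ₀(N)`
  (`Gamma0RankinSelbergUnfolding.lintegral_domain_mul_eisenstein_eq` + `lintegral_strip_normSq_mul_rpow`):
  `∫_{F_N} |f|²y² G_N(·, σ) dμ = 2 Σₙ |aₙ|² Γ(σ+1)(4πn)^{-(σ+1)}`;
* the Möbius decomposition `G_N = J_σ(N)⁻¹ Σ_{t∣N} μ(N/t) t^σ G₁(t·, σ)` (`Gamma0EisensteinMoebius`);
* the scaled unfolding `∫_{F_N} |f|²y² G₁(t·, σ) = ∫_𝒟 G_f^{(t)} G₁(·, σ)` (`Gamma0RankinSelbergScaledUnfolding`);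
* the level-one horocycle unfolding `∫_𝒟 G E(·, s) dμ = Γ(s+κ-1) a^{-(s+κ-1)} D(s+κ-1)`
  (`Literature.NumberTheory.Automorphic.setIntegral_fd_mul_eisensteinE_eq`) for the horocycle datum
  `(G_f^{(t)}, conjCoeff_t, a_t = 4π/(Nt), κ = 2)` (`conjTrace_horocycle_datum`).

Results (`f ∈ S₂(Γ₀(N))`, `N ≥ 1`, `aₙ = cuspCoeff f n`):

* `lintegral_domain_normSq_mul_levelEisensteinG` — Step A in the present names (`ℝ≥0∞`);
* `setIntegral_conjTrace_mul_eisensteinE`, `integrableOn_conjTrace_mul_eisensteinE` — the datum fed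
  to the level-one unfolding (complex `s`, `Re s > 1`);
* `lintegral_fd_conjTrace_mul_levelEisensteinG_lt_top`, `integral_fd_conjTrace_mul_levelEisensteinG` —
  finiteness and the value `∫_𝒟 G_f^{(t)} G₁(·, σ) dμ = 2Γ(σ+1) a_t^{-(σ+1)} Σ conjCoeff_t(n) n^{-(σ+1)}`;
* **`two_mul_tsum_normSq_cuspCoeff_eq_sum_divisors`** — the assembled real identity
  `2Σₙ |aₙ|² Γ(σ+1)(4πn)^{-(σ+1)} = J_σ(N)⁻¹ Σ_{t∣N} μ(N/t) t^σ ∫_𝒟 G_f^{(t)} G₁(·, σ) dμ`;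
* **`LSeries_normSq_cuspCoeff_eq_sum_divisors`** — the Dirichlet-series form, as complex numbers at
  real `σ > 1`: `L(|a|², σ+1) = J_σ(N)⁻¹ Σ_{t∣N} μ(N/t) t^σ (Nt)^{σ+1} L(conjCoeff_t, σ+1)`.

The right side continues meromorphically through the entire functions `J₀` of the data
(`RankinSelbergContinuationSL2.differentiable_J₀`); that is the next file.

## References

* R. A. Rankin, Proc. Cambridge Philos. Soc. 35 (1939), 357–372, Thm. 3, §4. [Rankin1939]
* H. Iwaniec, *Spectral Methods of Automorphic Forms*, GSM 53, §3.2, §7.1; D. Zagier, J. Fac. Sci.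
  Univ. Tokyo 28 (1981), §1.
-/

noncomputable section

open scoped MatrixGroups ModularForm Modular Real Topology ENNReal NNReal Pointwise
open UpperHalfPlane hiding I
open MeasureTheory Set Filter ModularGroup ConjAct CongruenceSubgroup ArithmeticFunction
open scoped ArithmeticFunction.Moebius
open Literature.NumberTheory.Automorphic

namespace Literature.NumberTheory.EllipticCurves.ModularForms

variable {N : ℕ} [NeZero N]

/-! ### Step A in the present names -/

section StepA

variable [Fintype (↥𝒮ℒ ⧸ (Gamma0 N : Subgroup (GL (Fin 2) ℝ)).subgroupOf 𝒮ℒ)]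
variable (g : (↥𝒮ℒ ⧸ (Gamma0 N : Subgroup (GL (Fin 2) ℝ)).subgroupOf 𝒮ℒ) → SL(2, ℤ))
  (hg : ∀ q, (Matrix.SpecialLinearGroup.mapGL ℝ (g q) : GL (Fin 2) ℝ) = ((q.out : ↥𝒮ℒ) : GL (Fin 2) ℝ))

include hg in
/-- **Step A of the Rankin–Selberg unfolding on `Γ₀(N)`** (the tree's
`lintegral_domain_mul_eisenstein_eq` and `lintegral_strip_normSq_mul_rpow`, in the names of
`Gamma0EisensteinMoebius`): for `f ∈ S₂(Γ₀(N))` and real `σ > 1`,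
`∫⁻_{F_N} |f(τ)|²(Im τ)² G_N(τ, σ) dμ(τ) = 2 Σₙ |aₙ|² Γ(σ+1)(4πn)^{-(σ+1)}` (`ℝ≥0∞`).
[cite: Rankin1939, §4 (4.4.2)] -/
theorem lintegral_domain_normSq_mul_levelEisensteinG (f : CuspForm (Gamma0 N) 2) {σ : ℝ} (hσ : 1 < σ) :
    ∫⁻ τ in ⋃ q, {τ : ℍ | g q • τ ∈ 𝒟ᵒ},
        ENNReal.ofReal (‖f τ‖ ^ 2 * τ.im ^ 2) * ENNReal.ofReal (levelEisensteinG N τ σ) =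
      2 * ∑' n : ℕ, ENNReal.ofReal (‖cuspCoeff f n‖ ^ 2 * ((1 / (4 * π * n)) ^ (σ + 1) * Real.Gamma (σ + 1))) := by
  have hΓ : (1 : ℝ) ∈ (Gamma0 N : Subgroup (GL (Fin 2) ℝ)).strictPeriods :=
    strictWidthInfty_Gamma0 N ▸ Subgroup.strictWidthInfty_mem_strictPeriods _
  have hq : ∀ (τ : ℍ) (p : Fin 2 → ℤ), 0 ≤ τ.im / Complex.normSq ((p 0 : ℂ) * τ + p 1) := fun τ p ↦
    div_nonneg τ.im_pos.le (Complex.normSq_nonneg _)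
  have hΦm : Measurable fun τ : ℍ ↦ ENNReal.ofReal (‖f τ‖ ^ 2 * τ.im ^ 2) :=
    (((ModularFormClass.continuous f).norm.pow 2).mul (continuous_im.pow 2)).measurable.ennreal_ofReal
  have hΦinv : ∀ δ ∈ Gamma0 N, ∀ τ : ℍ,
      ENNReal.ofReal (‖f (δ • τ)‖ ^ 2 * (δ • τ).im ^ 2) = ENNReal.ofReal (‖f τ‖ ^ 2 * τ.im ^ 2) := by
    intro δ hδ τ; rw [normSq_mul_im_sq_smul f hδ τ]
  have hU := lintegral_domain_mul_eisenstein_eq g hg (fun τ ↦ ENNReal.ofReal (‖f τ‖ ^ 2 * τ.im ^ 2)) hΦm hΦinv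
    (fun y ↦ ENNReal.ofReal (y ^ σ)) ((measurable_id.pow_const σ).ennreal_ofReal)
  have hinner : ∀ τ : ℍ, ∑' v : {v : Fin 2 → ℤ // IsCoprime (v 0) (v 1) ∧ (N : ℤ) ∣ v 0},
      ENNReal.ofReal ((τ.im / Complex.normSq ((v.1 0 : ℂ) * τ + v.1 1)) ^ σ) =
        ENNReal.ofReal (levelEisensteinG N τ σ) := by
    intro τ
    unfold levelEisensteinG
    exact (ENNReal.ofReal_tsum_of_nonneg (fun v ↦ Real.rpow_nonneg (hq τ _) _)
      ((summable_rpow_im_div_normSq τ hσ).comp_injective Subtype.val_injective)).symm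
  simp_rw [hinner] at hU
  rw [hU]
  have hstrip : ∫⁻ ρ in {ρ : ℍ | 0 ≤ ρ.re ∧ ρ.re < 1},
      ENNReal.ofReal (‖f ρ‖ ^ 2 * ρ.im ^ 2) * ENNReal.ofReal (ρ.im ^ σ) =
        ∫⁻ ρ in {ρ : ℍ | 0 ≤ ρ.re ∧ ρ.re < 1}, ENNReal.ofReal (‖f ρ‖ ^ 2 * ρ.im ^ (σ + 2)) := by
    refine lintegral_congr fun ρ ↦ ?_
    rw [← ENNReal.ofReal_mul (by positivity)]
    congr 1
    rw [Real.rpow_add ρ.im_pos σ 2, Real.rpow_two]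
    ring
  rw [hstrip, lintegral_strip_normSq_mul_rpow hΓ f (a := σ + 2) (by linarith)]
  congr 1
  refine tsum_congr fun n ↦ ?_
  rw [show σ + 2 - 1 = σ + 1 by ring]

end StepA

/-! ### The conjugated trace against the level-one Eisenstein series -/

section ConjTraceEisenstein

variable {t : ℕ} [NeZero t]

/-- **The level-one unfolding for the datum `G_f^{(t)}`**: for `f ∈ S₂(Γ₀(N))`, `t ≥ 1`, `Re s > 1`,
`∫_𝒟 G_f^{(t)}(w) E(w, s) dμ(w) = Γ(s+1) (4π/(Nt))^{-(s+1)} Σₙ conjCoeff_t(n) n^{-(s+1)}`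
(`Literature.NumberTheory.Automorphic.setIntegral_fd_mul_eisensteinE_eq` with
`conjTrace_horocycle_datum`). [cite: Rankin1939, §4 Thm. 1 (i)] -/
theorem setIntegral_conjTrace_mul_eisensteinE (f : CuspForm (Gamma0 N) 2) {s : ℂ} (hs : 1 < s.re) :
    ∫ w in 𝒟, (conjTrace N t f w : ℂ) * eisensteinE w s =
      Complex.Gamma (s + 1) * ((4 * π / ((N * t : ℕ) : ℝ) : ℝ) : ℂ) ^ (-(s + 1)) *
        LSeries (fun n ↦ (conjCoeff N t f n : ℂ)) (s + 1) := by
  obtain ⟨B, -, hB⟩ := exists_conjTrace_le (N := N) (t := t) f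
  obtain ⟨hGc, hGinv, hG0, hGB, hC, hC0, ha, hκ, hsum, hle, hm⟩ := conjTrace_horocycle_datum f hB
  have h := setIntegral_fd_mul_eisensteinE_eq hGc hGinv hG0 hGB hC hC0 ha hκ hsum hle hm hs
  rw [h, show s + (2 : ℝ) - 1 = s + 1 by push_cast; ring]

/-- Integrability of `G_f^{(t)} E(·, s)` on `𝒟` for `Re s > 1`. [folklore] -/
theorem integrableOn_conjTrace_mul_eisensteinE (f : CuspForm (Gamma0 N) 2) {s : ℂ} (hs : 1 < s.re) :
    IntegrableOn (fun w : ℍ ↦ (conjTrace N t f w : ℂ) * eisensteinE w s) 𝒟 := by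
  obtain ⟨B, -, hB⟩ := exists_conjTrace_le (N := N) (t := t) f
  obtain ⟨hGc, hGinv, hG0, hGB, hC, hC0, ha, hκ, hsum, -, hm⟩ := conjTrace_horocycle_datum f hB
  exact integrableOn_fd_mul_eisensteinE hGc hGinv hG0 hGB hC hC0 ha hκ hsum hm hs

/-- The Dirichlet series of `conjCoeff_t` converges absolutely for `Re w > 2`. [folklore] -/
theorem LSeriesSummable_conjCoeff (f : CuspForm (Gamma0 N) 2) {w : ℂ} (hw : 2 < w.re) :
    LSeriesSummable (fun n ↦ (conjCoeff N t f n : ℂ)) w := by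
  obtain ⟨B, -, hB⟩ := exists_conjTrace_le (N := N) (t := t) f
  obtain ⟨-, -, -, -, hC, -, ha, hκ, hsum, hle, -⟩ := conjTrace_horocycle_datum f hB
  exact LSeriesSummable_of_horocycle hC ha hκ hsum hle (by simpa using hw)

/-- For real `σ`: `E(w, σ) = G₁(w, σ)/2` as a real number (`levelEisensteinG 1 = 2E`). [folklore] -/
theorem eisensteinE_ofReal_eq (w : ℍ) (σ : ℝ) :
    eisensteinE w σ = ((levelEisensteinG 1 w σ / 2 : ℝ) : ℂ) := by
  have h := ofReal_levelEisensteinG_one w σ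
  push_cast
  rw [h]; ring

/-- **Finiteness**: `∫⁻_𝒟 G_f^{(t)} G₁(·, σ) dμ < ∞` for real `σ > 1`. [folklore] -/
theorem lintegral_fd_conjTrace_mul_levelEisensteinG_lt_top (f : CuspForm (Gamma0 N) 2) {σ : ℝ} (hσ : 1 < σ) :
    ∫⁻ w in 𝒟, ENNReal.ofReal (conjTrace N t f w) * ENNReal.ofReal (levelEisensteinG 1 w σ) < ∞ := by
  have hint := integrableOn_conjTrace_mul_eisensteinE (N := N) (t := t) f (s := σ) (by simpa using hσ)
  have h2 := hint.hasFiniteIntegral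
  rw [HasFiniteIntegral] at h2
  have hle : ∫⁻ w in 𝒟, ENNReal.ofReal (conjTrace N t f w) * ENNReal.ofReal (levelEisensteinG 1 w σ) ≤
      2 * ∫⁻ w in 𝒟, ‖(conjTrace N t f w : ℂ) * eisensteinE w σ‖ₑ := by
    rw [← lintegral_const_mul' 2 _ (by norm_num)]
    refine lintegral_mono fun w ↦ ?_
    rw [eisensteinE_ofReal_eq, ← Complex.ofReal_mul, enorm_eq_nnnorm, Complex.nnnorm_real, ← enorm_eq_nnnorm,
      Real.enorm_eq_ofReal (mul_nonneg (conjTrace_nonneg (N := N) (t := t) f w)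
        (div_nonneg (levelEisensteinG_nonneg 1 w σ) (by norm_num))),
      ← ENNReal.ofReal_mul (conjTrace_nonneg (N := N) (t := t) f w), show (2 : ℝ≥0∞) = ENNReal.ofReal 2 by norm_num,
      ← ENNReal.ofReal_mul (by norm_num)]
    exact ENNReal.ofReal_le_ofReal (by nlinarith [conjTrace_nonneg (N := N) (t := t) f w, levelEisensteinG_nonneg 1 w σ])
  exact hle.trans_lt (ENNReal.mul_lt_top (by norm_num) h2)

/-- **The value**: `∫_𝒟 G_f^{(t)} G₁(·, σ) dμ = 2Γ(σ+1)(4π/(Nt))^{-(σ+1)} Σₙ conjCoeff_t(n) n^{-(σ+1)}`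
(real `σ > 1`; as complex numbers). [cite: Rankin1939, §4 Thm. 1 (i)] -/
theorem integral_fd_conjTrace_mul_levelEisensteinG (f : CuspForm (Gamma0 N) 2) {σ : ℝ} (hσ : 1 < σ) :
    ((∫ w in 𝒟, conjTrace N t f w * levelEisensteinG 1 w σ : ℝ) : ℂ) =
      2 * (Complex.Gamma (σ + 1) * ((4 * π / ((N * t : ℕ) : ℝ) : ℝ) : ℂ) ^ (-((σ : ℂ) + 1)) *
        LSeries (fun n ↦ (conjCoeff N t f n : ℂ)) (σ + 1)) := by
  have h := setIntegral_conjTrace_mul_eisensteinE (N := N) (t := t) f (s := σ) (by simpa using hσ)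
  have hpt : ∀ w : ℍ, (conjTrace N t f w : ℂ) * eisensteinE w σ =
      ((conjTrace N t f w * levelEisensteinG 1 w σ / 2 : ℝ) : ℂ) := by
    intro w; rw [eisensteinE_ofReal_eq]; push_cast; ring
  simp_rw [hpt] at h
  rw [integral_complex_ofReal] at h
  have h2 : (∫ w in 𝒟, conjTrace N t f w * levelEisensteinG 1 w σ / 2) =
      (∫ w in 𝒟, conjTrace N t f w * levelEisensteinG 1 w σ) / 2 := by
    simp_rw [div_eq_mul_inv]; rw [integral_mul_const]
  rw [h2] at h
  have h3 : ((∫ w in 𝒟, conjTrace N t f w * levelEisensteinG 1 w σ : ℝ) : ℂ) =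
      2 * (((∫ w in 𝒟, conjTrace N t f w * levelEisensteinG 1 w σ) / 2 : ℝ) : ℂ) := by
    push_cast; ring
  rw [h3, h]

/-- The real integral as the `toReal` of the Lebesgue integral. [folklore] -/
theorem integral_fd_conjTrace_mul_levelEisensteinG_eq_toReal (f : CuspForm (Gamma0 N) 2) {σ : ℝ} (hσ : 1 < σ) :
    (∫ w in 𝒟, conjTrace N t f w * levelEisensteinG 1 w σ) =
      (∫⁻ w in 𝒟, ENNReal.ofReal (conjTrace N t f w) * ENNReal.ofReal (levelEisensteinG 1 w σ)).toReal := by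
  have hG1m : Measurable fun w : ℍ ↦ levelEisensteinG 1 w σ := by
    unfold levelEisensteinG; exact measurable_tsum_coprime_dvd hσ 1
  have hnn : ∀ w, 0 ≤ conjTrace N t f w * levelEisensteinG 1 w σ := fun w ↦
    mul_nonneg (conjTrace_nonneg (N := N) (t := t) f w) (levelEisensteinG_nonneg 1 w σ)
  rw [integral_eq_lintegral_of_nonneg_ae (Eventually.of_forall hnn)
    (((continuous_conjTrace (N := N) (t := t) f).measurable.mul hG1m).aestronglyMeasurable)]
  congr 1
  refine lintegral_congr fun w ↦ ?_
  rw [ENNReal.ofReal_mul (conjTrace_nonneg (N := N) (t := t) f w)]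

end ConjTraceEisenstein

/-! ### The assembly at real `σ > 1` -/

section Assembly

variable [Fintype (↥𝒮ℒ ⧸ (Gamma0 N : Subgroup (GL (Fin 2) ℝ)).subgroupOf 𝒮ℒ)]
variable (g : (↥𝒮ℒ ⧸ (Gamma0 N : Subgroup (GL (Fin 2) ℝ)).subgroupOf 𝒮ℒ) → SL(2, ℤ))
  (hg : ∀ q, (Matrix.SpecialLinearGroup.mapGL ℝ (g q) : GL (Fin 2) ℝ) = ((q.out : ↥𝒮ℒ) : GL (Fin 2) ℝ))

include hg in
/-- For `t ∣ N`: the real integral `∫_{F_N} |f|²y² G₁(t·, σ) dμ` equals `∫_𝒟 G_f^{(t)} G₁(·, σ) dμ`, and the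
integrand is integrable on `F_N` (real `σ > 1`). [cite: Rankin1939, §4] -/
theorem integral_domain_normSq_mul_levelEisensteinG_scaled {t : ℕ} [NeZero t] (htN : t ∣ N)
    (f : CuspForm (Gamma0 N) 2) {σ : ℝ} (hσ : 1 < σ) :
    IntegrableOn (fun τ : ℍ ↦ ‖f τ‖ ^ 2 * τ.im ^ 2 *
        levelEisensteinG 1 ((⟨t, by exact_mod_cast NeZero.pos t⟩ : {x : ℝ // 0 < x}) • τ) σ)
        (⋃ q, {τ : ℍ | g q • τ ∈ 𝒟ᵒ}) ∧
      (∫ τ in ⋃ q, {τ : ℍ | g q • τ ∈ 𝒟ᵒ}, ‖f τ‖ ^ 2 * τ.im ^ 2 *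
          levelEisensteinG 1 ((⟨t, by exact_mod_cast NeZero.pos t⟩ : {x : ℝ // 0 < x}) • τ) σ) =
        ∫ w in 𝒟, conjTrace N t f w * levelEisensteinG 1 w σ := by
  set tpos : {x : ℝ // 0 < x} := ⟨t, by exact_mod_cast NeZero.pos t⟩ with htpos
  have hkey := lintegral_domain_petDensity_mul_levelEisensteinG_scaled g hg htN f hσ
  have hfin := lintegral_fd_conjTrace_mul_levelEisensteinG_lt_top (N := N) (t := t) f hσ
  have hG1m : Measurable fun w : ℍ ↦ levelEisensteinG 1 w σ := by
    unfold levelEisensteinG; exact measurable_tsum_coprime_dvd hσ 1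
  have hsm : Continuous fun τ : ℍ ↦ tpos • τ := by
    have e : (fun τ : ℍ ↦ tpos • τ) = fun τ ↦ (scaleGL t)⁻¹ • τ :=
      funext fun τ ↦ (scaleGL_inv_smul_eq τ).symm
    rw [e]; exact continuous_const_smul _
  have hmeas : Measurable fun τ : ℍ ↦ ‖f τ‖ ^ 2 * τ.im ^ 2 * levelEisensteinG 1 (tpos • τ) σ :=
    (((ModularFormClass.continuous f).norm.pow 2).mul (continuous_im.pow 2)).measurable.mul
      (hG1m.comp hsm.measurable)
  have hnn : ∀ τ : ℍ, 0 ≤ ‖f τ‖ ^ 2 * τ.im ^ 2 * levelEisensteinG 1 (tpos • τ) σ := fun τ ↦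
    mul_nonneg (by positivity) (levelEisensteinG_nonneg 1 _ σ)
  have hlint : ∫⁻ τ in ⋃ q, {τ : ℍ | g q • τ ∈ 𝒟ᵒ},
      ENNReal.ofReal (‖f τ‖ ^ 2 * τ.im ^ 2 * levelEisensteinG 1 (tpos • τ) σ) =
      ∫⁻ w in 𝒟, ENNReal.ofReal (conjTrace N t f w) * ENNReal.ofReal (levelEisensteinG 1 w σ) := by
    rw [← hkey]
    refine lintegral_congr fun τ ↦ ?_
    rw [ENNReal.ofReal_mul (by positivity)]
  have hint : IntegrableOn (fun τ : ℍ ↦ ‖f τ‖ ^ 2 * τ.im ^ 2 * levelEisensteinG 1 (tpos • τ) σ)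
      (⋃ q, {τ : ℍ | g q • τ ∈ 𝒟ᵒ}) := by
    refine ⟨hmeas.aestronglyMeasurable, ?_⟩
    rw [HasFiniteIntegral]
    have e : ∀ τ : ℍ, ‖‖f τ‖ ^ 2 * τ.im ^ 2 * levelEisensteinG 1 (tpos • τ) σ‖ₑ =
        ENNReal.ofReal (‖f τ‖ ^ 2 * τ.im ^ 2 * levelEisensteinG 1 (tpos • τ) σ) := fun τ ↦
      Real.enorm_eq_ofReal (hnn τ)
    simp_rw [e]
    rw [hlint]
    exact hfin
  refine ⟨hint, ?_⟩
  rw [integral_eq_lintegral_of_nonneg_ae (Eventually.of_forall hnn) hmeas.aestronglyMeasurable, hlint,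
    ← integral_fd_conjTrace_mul_levelEisensteinG_eq_toReal f hσ]

include hg in
/-- **The assembled identity at real `σ > 1`**: for `f ∈ S₂(Γ₀(N))`,
`2 Σₙ |aₙ|² Γ(σ+1)(4πn)^{-(σ+1)} = J_σ(N)⁻¹ Σ_{t ∣ N} μ(N/t) t^σ ∫_𝒟 G_f^{(t)} G₁(·, σ) dμ`
(Step A, the Möbius decomposition of `G_N`, and the scaled unfolding term by term).
[cite: Rankin1939, §4] -/
theorem two_mul_tsum_normSq_cuspCoeff_eq_sum_divisors (f : CuspForm (Gamma0 N) 2) {σ : ℝ} (hσ : 1 < σ) :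
    2 * ∑' n : ℕ, ‖cuspCoeff f n‖ ^ 2 * ((1 / (4 * π * n)) ^ (σ + 1) * Real.Gamma (σ + 1)) =
      (moebiusWeight σ N)⁻¹ * ∑ t ∈ N.divisors.attach, (μ (N / t.1) : ℝ) * ((t.1 : ℝ) ^ σ *
        ∫ w in 𝒟, conjTrace N t.1 f w * levelEisensteinG 1 w σ) := by
  have hN : 0 < N := NeZero.pos N
  set F : Set ℍ := ⋃ q, {τ : ℍ | g q • τ ∈ 𝒟ᵒ} with hFdef
  -- the terms `c n = |aₙ|² Γ(σ+1)(4πn)^{-(σ+1)} ≥ 0`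
  set c : ℕ → ℝ := fun n ↦ ‖cuspCoeff f n‖ ^ 2 * ((1 / (4 * π * n)) ^ (σ + 1) * Real.Gamma (σ + 1)) with hc
  have hc0 : ∀ n, 0 ≤ c n := fun n ↦ by
    have : 0 < Real.Gamma (σ + 1) := Real.Gamma_pos_of_pos (by linarith)
    rw [hc]; positivity
  -- Step A and the decomposition, as real integrals over `F`
  have stepA := lintegral_domain_normSq_mul_levelEisensteinG g hg f hσ
  have hΦm : Measurable fun τ : ℍ ↦ ‖f τ‖ ^ 2 * τ.im ^ 2 :=
    (((ModularFormClass.continuous f).norm.pow 2).mul (continuous_im.pow 2)).measurable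
  have hGNm : Measurable fun τ : ℍ ↦ levelEisensteinG N τ σ := by
    unfold levelEisensteinG; exact measurable_tsum_coprime_dvd hσ N
  -- each scaled term is integrable with the right integral
  have hterm : ∀ t : {x // x ∈ N.divisors},
      IntegrableOn (fun τ : ℍ ↦ ‖f τ‖ ^ 2 * τ.im ^ 2 *
        levelEisensteinG 1 ((⟨t.1, by exact_mod_cast Nat.pos_of_mem_divisors t.2⟩ : {x : ℝ // 0 < x}) • τ) σ) F ∧
      (∫ τ in F, ‖f τ‖ ^ 2 * τ.im ^ 2 *
        levelEisensteinG 1 ((⟨t.1, by exact_mod_cast Nat.pos_of_mem_divisors t.2⟩ : {x : ℝ // 0 < x}) • τ) σ) =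
        ∫ w in 𝒟, conjTrace N t.1 f w * levelEisensteinG 1 w σ := by
    intro t
    haveI : NeZero t.1 := ⟨(Nat.pos_of_mem_divisors t.2).ne'⟩
    exact integral_domain_normSq_mul_levelEisensteinG_scaled g hg (Nat.dvd_of_mem_divisors t.2) f hσ
  -- the pointwise decomposition of the integrand
  have hpt : ∀ τ : ℍ, ‖f τ‖ ^ 2 * τ.im ^ 2 * levelEisensteinG N τ σ =
      (moebiusWeight σ N)⁻¹ * ∑ t ∈ N.divisors.attach, (μ (N / t.1) : ℝ) * ((t.1 : ℝ) ^ σ *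
        (‖f τ‖ ^ 2 * τ.im ^ 2 *
          levelEisensteinG 1 ((⟨t.1, by exact_mod_cast Nat.pos_of_mem_divisors t.2⟩ : {x : ℝ // 0 < x}) • τ) σ)) := by
    intro τ
    rw [levelEisensteinG_eq_inv_mul_sum τ hσ hN, Finset.mul_sum, Finset.mul_sum, Finset.mul_sum]
    refine Finset.sum_congr rfl fun t _ ↦ ?_
    ring
  -- integrate the decomposition
  have hdecomp : (∫ τ in F, ‖f τ‖ ^ 2 * τ.im ^ 2 * levelEisensteinG N τ σ) =
      (moebiusWeight σ N)⁻¹ * ∑ t ∈ N.divisors.attach, (μ (N / t.1) : ℝ) * ((t.1 : ℝ) ^ σ *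
        ∫ w in 𝒟, conjTrace N t.1 f w * levelEisensteinG 1 w σ) := by
    simp_rw [hpt]
    rw [integral_const_mul, integral_finsetSum _ (fun t _ ↦ ((hterm t).1.const_mul _).const_mul _)]
    congr 1
    refine Finset.sum_congr rfl fun t _ ↦ ?_
    rw [integral_const_mul, integral_const_mul, (hterm t).2]
  -- the left side: `2 Σ c n = ∫_F |f|²y² G_N`
  have hnn : ∀ τ : ℍ, 0 ≤ ‖f τ‖ ^ 2 * τ.im ^ 2 * levelEisensteinG N τ σ := fun τ ↦
    mul_nonneg (by positivity) (levelEisensteinG_nonneg N τ σ)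
  have hlhs : (∫ τ in F, ‖f τ‖ ^ 2 * τ.im ^ 2 * levelEisensteinG N τ σ) =
      (2 * ∑' n : ℕ, ENNReal.ofReal (c n)).toReal := by
    rw [integral_eq_lintegral_of_nonneg_ae (Eventually.of_forall hnn) (hΦm.mul hGNm).aestronglyMeasurable,
      ← stepA]
    congr 1
    refine lintegral_congr fun τ ↦ ?_
    rw [ENNReal.ofReal_mul (by positivity)]
  -- finiteness of `Σ c n`: the real integral is finite, hence so is Step A's right side
  have hsumfin : ∑' n : ℕ, ENNReal.ofReal (c n) ≠ ∞ := by
    intro htop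
    -- then the `lintegral` in Step A is infinite, contradicting the integrability of the pieces
    have hinf : ∫⁻ τ in F, ENNReal.ofReal (‖f τ‖ ^ 2 * τ.im ^ 2) * ENNReal.ofReal (levelEisensteinG N τ σ) = ∞ := by
      rw [stepA, htop, ENNReal.mul_top two_ne_zero]
    have hint : IntegrableOn (fun τ : ℍ ↦ ‖f τ‖ ^ 2 * τ.im ^ 2 * levelEisensteinG N τ σ) F := by
      have e : (fun τ : ℍ ↦ ‖f τ‖ ^ 2 * τ.im ^ 2 * levelEisensteinG N τ σ) = fun τ ↦
          (moebiusWeight σ N)⁻¹ * ∑ t ∈ N.divisors.attach, (μ (N / t.1) : ℝ) * ((t.1 : ℝ) ^ σ *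
            (‖f τ‖ ^ 2 * τ.im ^ 2 *
              levelEisensteinG 1 ((⟨t.1, by exact_mod_cast Nat.pos_of_mem_divisors t.2⟩ : {x : ℝ // 0 < x}) • τ) σ)) :=
        funext hpt
      rw [e]
      exact (integrable_finsetSum _ fun t _ ↦ ((hterm t).1.const_mul _).const_mul _).const_mul _
    have hfin := hint.hasFiniteIntegral
    rw [HasFiniteIntegral] at hfin
    have e2 : ∫⁻ τ in F, ‖‖f τ‖ ^ 2 * τ.im ^ 2 * levelEisensteinG N τ σ‖ₑ =
        ∫⁻ τ in F, ENNReal.ofReal (‖f τ‖ ^ 2 * τ.im ^ 2) * ENNReal.ofReal (levelEisensteinG N τ σ) := by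
      refine lintegral_congr fun τ ↦ ?_
      rw [Real.enorm_eq_ofReal (hnn τ), ENNReal.ofReal_mul (by positivity)]
    rw [e2, hinf] at hfin
    exact lt_irrefl _ hfin
  have hsumm : Summable c := by
    have h := ENNReal.tsum_toReal_eq (fun n ↦ (ENNReal.ofReal_ne_top : ENNReal.ofReal (c n) ≠ ∞))
    refine (ENNReal.summable_toReal hsumfin).congr fun n ↦ ?_
    rw [ENNReal.toReal_ofReal (hc0 n)]
  have hlhs' : (2 * ∑' n : ℕ, ENNReal.ofReal (c n)).toReal = 2 * ∑' n : ℕ, c n := by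
    rw [ENNReal.toReal_mul, ENNReal.tsum_toReal_eq (fun n ↦ ENNReal.ofReal_ne_top)]
    simp only [ENNReal.toReal_ofNat]
    congr 1
    exact tsum_congr fun n ↦ ENNReal.toReal_ofReal (hc0 n)
  rw [← hlhs', ← hlhs, hdecomp]

end Assembly

/-! ### The Dirichlet-series form -/

section Dirichlet

omit [NeZero N] in
/-- A Dirichlet series with real coefficients at a real point `x ≠ 0`, as the cast of a real `tsum`:
`L(b, x) = Σₙ bₙ n^{-x}` (the term `n = 0` vanishes on both sides). [folklore] -/
theorem LSeries_ofReal_apply_ofReal (b : ℕ → ℝ) {x : ℝ} (hx : x ≠ 0) :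
    LSeries (fun n ↦ (b n : ℂ)) x = ((∑' n : ℕ, b n * (n : ℝ) ^ (-x) : ℝ) : ℂ) := by
  rw [LSeries, Complex.ofReal_tsum]
  refine tsum_congr fun n ↦ ?_
  rcases Nat.eq_zero_or_pos n with rfl | hn
  · simp [LSeries.term, Real.zero_rpow (neg_ne_zero.mpr hx)]
  · rw [LSeries.term_of_ne_zero hn.ne', Complex.ofReal_mul, Real.rpow_neg (Nat.cast_nonneg n),
      Complex.ofReal_inv, Complex.ofReal_cpow (Nat.cast_nonneg n), div_eq_mul_inv]
    norm_cast

variable {t : ℕ} [NeZero t]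

/-- **The value in real terms**: `∫_𝒟 G_f^{(t)} G₁(·, σ) dμ = 2Γ(σ+1)(4π/(Nt))^{-(σ+1)} Σₙ conjCoeff_t(n) n^{-(σ+1)}`
(real `σ > 1`, all quantities real). [cite: Rankin1939, §4 Thm. 1 (i)] -/
theorem integral_fd_conjTrace_mul_levelEisensteinG_real (f : CuspForm (Gamma0 N) 2) {σ : ℝ} (hσ : 1 < σ) :
    (∫ w in 𝒟, conjTrace N t f w * levelEisensteinG 1 w σ) =
      2 * (Real.Gamma (σ + 1) * (4 * π / ((N * t : ℕ) : ℝ)) ^ (-(σ + 1)) *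
        ∑' n : ℕ, conjCoeff N t f n * (n : ℝ) ^ (-(σ + 1))) := by
  have h := integral_fd_conjTrace_mul_levelEisensteinG (N := N) (t := t) f hσ
  have hx : σ + 1 ≠ 0 := by linarith
  have ha : 0 ≤ 4 * π / ((N * t : ℕ) : ℝ) := by positivity
  rw [show ((σ : ℂ) + 1) = ((σ + 1 : ℝ) : ℂ) by push_cast; ring, LSeries_ofReal_apply_ofReal _ hx,
    Complex.Gamma_ofReal, show (-((σ + 1 : ℝ) : ℂ)) = ((-(σ + 1) : ℝ) : ℂ) by push_cast; ring,
    ← Complex.ofReal_cpow ha] at h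
  exact_mod_cast h

variable [Fintype (↥𝒮ℒ ⧸ (Gamma0 N : Subgroup (GL (Fin 2) ℝ)).subgroupOf 𝒮ℒ)]
variable (g : (↥𝒮ℒ ⧸ (Gamma0 N : Subgroup (GL (Fin 2) ℝ)).subgroupOf 𝒮ℒ) → SL(2, ℤ))
  (hg : ∀ q, (Matrix.SpecialLinearGroup.mapGL ℝ (g q) : GL (Fin 2) ℝ) = ((q.out : ↥𝒮ℒ) : GL (Fin 2) ℝ))

include hg in
/-- **Rankin's Dirichlet series through the horocycle data (real form).** For `f ∈ S₂(Γ₀(N))` and real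
`σ > 1`:
`Σₙ |aₙ|² n^{-(σ+1)} = J_σ(N)⁻¹ Σ_{t∣N} μ(N/t) t^σ (Nt)^{σ+1} Σₙ conjCoeff_t(n) n^{-(σ+1)}`
(cancel `2Γ(σ+1)(4π)^{-(σ+1)}` in `two_mul_tsum_normSq_cuspCoeff_eq_sum_divisors`). [cite: Rankin1939, §4] -/
theorem tsum_normSq_cuspCoeff_mul_rpow_eq_sum_divisors (f : CuspForm (Gamma0 N) 2) {σ : ℝ} (hσ : 1 < σ) :
    ∑' n : ℕ, ‖cuspCoeff f n‖ ^ 2 * (n : ℝ) ^ (-(σ + 1)) =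
      (moebiusWeight σ N)⁻¹ * ∑ t ∈ N.divisors.attach, (μ (N / t.1) : ℝ) * ((t.1 : ℝ) ^ σ *
        ((((N * t.1 : ℕ) : ℝ)) ^ (σ + 1) * ∑' n : ℕ, conjCoeff N t.1 f n * (n : ℝ) ^ (-(σ + 1)))) := by
  have hmain := two_mul_tsum_normSq_cuspCoeff_eq_sum_divisors g hg f hσ
  have hΓ : 0 < Real.Gamma (σ + 1) := Real.Gamma_pos_of_pos (by linarith)
  have h4π : 0 < (4 * π) ^ (-(σ + 1)) := Real.rpow_pos_of_pos (by positivity) _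
  -- left side: `c n = Γ(σ+1)(4π)^{-(σ+1)} |aₙ|² n^{-(σ+1)}`
  have hleft : ∑' n : ℕ, ‖cuspCoeff f n‖ ^ 2 * ((1 / (4 * π * n)) ^ (σ + 1) * Real.Gamma (σ + 1)) =
      Real.Gamma (σ + 1) * (4 * π) ^ (-(σ + 1)) * ∑' n : ℕ, ‖cuspCoeff f n‖ ^ 2 * (n : ℝ) ^ (-(σ + 1)) := by
    rw [← tsum_mul_left]
    refine tsum_congr fun n ↦ ?_
    have e : (1 / (4 * π * n)) ^ (σ + 1) = (4 * π) ^ (-(σ + 1)) * (n : ℝ) ^ (-(σ + 1)) := by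
      rw [one_div, Real.inv_rpow (by positivity), Real.mul_rpow (by positivity) (Nat.cast_nonneg n),
        mul_inv, Real.rpow_neg (by positivity), Real.rpow_neg (Nat.cast_nonneg n)]
    rw [e]; ring
  -- right side, term by term
  have hright : ∀ tt : {x // x ∈ N.divisors},
      (∫ w in 𝒟, conjTrace N tt.1 f w * levelEisensteinG 1 w σ) =
        Real.Gamma (σ + 1) * (4 * π) ^ (-(σ + 1)) *
          (2 * ((((N * tt.1 : ℕ) : ℝ)) ^ (σ + 1) * ∑' n : ℕ, conjCoeff N tt.1 f n * (n : ℝ) ^ (-(σ + 1)))) := by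
    intro tt
    haveI : NeZero tt.1 := ⟨(Nat.pos_of_mem_divisors tt.2).ne'⟩
    have hNt : 0 < ((N * tt.1 : ℕ) : ℝ) := by exact_mod_cast Nat.mul_pos (NeZero.pos N) (NeZero.pos tt.1)
    rw [integral_fd_conjTrace_mul_levelEisensteinG_real f hσ, Real.div_rpow (by positivity) hNt.le,
      Real.rpow_neg hNt.le, div_eq_mul_inv, inv_inv]
    ring
  rw [hleft] at hmain
  simp_rw [hright] at hmain
  -- cancel the common positive factor `2Γ(σ+1)(4π)^{-(σ+1)}`
  have hK : 0 < 2 * (Real.Gamma (σ + 1) * (4 * π) ^ (-(σ + 1))) := by positivity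
  refine mul_left_cancel₀ hK.ne' ?_
  calc 2 * (Real.Gamma (σ + 1) * (4 * π) ^ (-(σ + 1))) * ∑' n : ℕ, ‖cuspCoeff f n‖ ^ 2 * (n : ℝ) ^ (-(σ + 1))
      = 2 * (Real.Gamma (σ + 1) * (4 * π) ^ (-(σ + 1)) * ∑' n : ℕ, ‖cuspCoeff f n‖ ^ 2 * (n : ℝ) ^ (-(σ + 1))) := by
        ring
    _ = _ := hmain
    _ = 2 * (Real.Gamma (σ + 1) * (4 * π) ^ (-(σ + 1))) *
        ((moebiusWeight σ N)⁻¹ * ∑ t ∈ N.divisors.attach, (μ (N / t.1) : ℝ) * ((t.1 : ℝ) ^ σ *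
          ((((N * t.1 : ℕ) : ℝ)) ^ (σ + 1) * ∑' n : ℕ, conjCoeff N t.1 f n * (n : ℝ) ^ (-(σ + 1))))) := by
        rw [Finset.mul_sum, Finset.mul_sum, Finset.mul_sum]
        refine Finset.sum_congr rfl fun tt _ ↦ ?_
        ring

include hg in
/-- **Rankin's Dirichlet series through the horocycle data (Dirichlet-series form).** For
`f ∈ S₂(Γ₀(N))` and real `σ > 1`, as complex numbers:
`L(|a|², σ+1) = J_σ(N)⁻¹ Σ_{t∣N} μ(N/t) t^σ (Nt)^{σ+1} L(conjCoeff_t, σ+1)`, where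
`L(conjCoeff_t, ·)` is the Dirichlet series of the horocycle datum `G_f^{(t)}` on the modular surface —
the series which the entire functions `J₀` of `RankinSelbergContinuationSL2` continue. [cite: Rankin1939, §4 Thm. 3] -/
theorem LSeries_normSq_cuspCoeff_eq_sum_divisors (f : CuspForm (Gamma0 N) 2) {σ : ℝ} (hσ : 1 < σ) :
    LSeries (fun n ↦ ((‖cuspCoeff f n‖ ^ 2 : ℝ) : ℂ)) ((σ + 1 : ℝ) : ℂ) =
      (((moebiusWeight σ N)⁻¹ : ℝ) : ℂ) * ∑ t ∈ N.divisors.attach, ((μ (N / t.1) : ℝ) : ℂ) *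
        ((((t.1 : ℝ) ^ σ * ((N * t.1 : ℕ) : ℝ) ^ (σ + 1) : ℝ)) : ℂ) *
          LSeries (fun n ↦ (conjCoeff N t.1 f n : ℂ)) ((σ + 1 : ℝ) : ℂ) := by
  have hx : σ + 1 ≠ 0 := by linarith
  rw [LSeries_ofReal_apply_ofReal _ hx, tsum_normSq_cuspCoeff_mul_rpow_eq_sum_divisors g hg f hσ]
  simp_rw [LSeries_ofReal_apply_ofReal _ hx]
  push_cast
  refine congrArg _ (Finset.sum_congr rfl fun tt _ ↦ ?_)
  ring

end Dirichlet

end Literature.NumberTheory.EllipticCurves.ModularForms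

end
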